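import Summits.NavierStokesRegularity.NavierStokesRegularity.Theorems.AdaptedFrequencyAdaptedFrequencyConvergesBernoulliCloudIdentity
import HarnessLib

/-!
# The Bernoulli–cloud identity, adjoint form `ν H = −∫ p ∂ₜG − dB/dt` — crux
# stmt-NavierStokesRegularity-10493 (`AdaptedFrequency.AdaptedFrequencyConverges`), line
# cloud-frame-effective-tsai (lead c1 by-product: card lever 2)

Theorems only (`--supports stmt-NavierStokesRegularity-10493`). Inserting the adjoint equation
`∂ₜG = −(u·∇G + νΔG)` of the flow-adapted backward kernel (`IsAdaptedBackwardKernel`; at an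
interior time the one-sided time derivative of the kernel clause is the two-sided one) into the
Bernoulli–cloud identity `bernoulliCloud_hasDerivAt` of `…BernoulliCloudIdentity` gives

* `bernoulliCloud_hasDerivAt_adjointForm`: `B′(t) = −∫ p(t) ∂ₜG(t) − ν H(t)` for the
  kernel-weighted energy `B = ∫ ½‖u‖² G` and the adapted enstrophy `H = adaptedEnstrophy u G`;
* `adaptedEnstrophy_eq_of_bernoulliCloud`: for `ν ≠ 0`, **Tsai's formula for the cloud**
  `H(t) = −(∫ p(t) ∂ₜG(t) + B′(t)) / ν` — the adapted enstrophy is read off the pressure paired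
  with the time derivative of the kernel and the time derivative of the kernel-weighted energy; in
  particular a steady cloud (`∂ₜG = 0`, `B′ = 0`) has `H = 0` (Tsai 1998, §5, in one line).
-/

noncomputable section

namespace Summit.NavierStokesRegularity.NavierStokesRegularity.Theorems.AdaptedFrequencyConverges.CloudFrameEffectiveTsai

open scoped Topology InnerProductSpace RealInnerProductSpace Laplacian ContDiff
open Literature.Analysis.FluidPDE Set Filter MeasureTheory Function Metric

section R3

/-- **The Bernoulli–cloud identity, adjoint form.** Under the hypotheses of
`bernoulliCloud_hasDerivAt` (classical unforced Navier–Stokes solution on an open `S₀`, adapted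
backward kernel `G` on `S ⊇ S₀` with integrable majorant, uniform bounds on `u, Du, D²u, ∂ₜu`,
linear growth of `p`, integrable `(1 + ‖x‖)‖∇G‖` and `(1 + ‖x‖)|ΔG|`), for every `t ∈ S₀`:
`d/dt ∫ ½‖u‖² G = −∫ p(t, x) ∂ₜG(t, x) dx − ν · adaptedEnstrophy u G t`
(the adjoint equation `u·∇G + νΔG = −∂ₜG`, two-sided at the interior time `t`). -/
theorem bernoulliCloud_hasDerivAt_adjointForm {ν T K : ℝ}
    {u : ℝ → EuclideanSpace ℝ (Fin 3) → EuclideanSpace ℝ (Fin 3)}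
    {p : ℝ → EuclideanSpace ℝ (Fin 3) → ℝ}
    {S S₀ : Set ℝ} {x₀ : EuclideanSpace ℝ (Fin 3)} {G : ℝ → EuclideanSpace ℝ (Fin 3) → ℝ}
    {M : EuclideanSpace ℝ (Fin 3) → ℝ}
    (hG : IsAdaptedBackwardKernel ν u S T x₀ G) (hS₀ : IsOpen S₀) (hS₀S : S₀ ⊆ S)
    (hcl : IsClassicalNSSolutionOn S₀ ν 0 u p)
    (hM : Integrable M) (hGM : ∀ t ∈ S₀, ∀ x, G t x ≤ M x)
    (hU : ∀ t ∈ S₀, ∀ x, ‖u t x‖ ≤ K) (hDu : ∀ t ∈ S₀, ∀ x, ‖fderiv ℝ (u t) x‖ ≤ K)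
    (hD2u : ∀ t ∈ S₀, ∀ x, ‖iteratedFDeriv ℝ 2 (u t) x‖ ≤ K)
    (hut : ∀ t ∈ S₀, ∀ x, ‖deriv (fun s => u s x) t‖ ≤ K)
    (hp : ∀ t ∈ S₀, ∀ x, |p t x| ≤ K * (1 + ‖x‖))
    (hDG : ∀ t ∈ S₀, Integrable fun x => (1 + ‖x‖) * ‖fderiv ℝ (G t) x‖)
    (hΔG : ∀ t ∈ S₀, Integrable fun x => (1 + ‖x‖) * |(Δ (G t)) x|) {t : ℝ} (ht : t ∈ S₀) :
    HasDerivAt (fun s => ∫ x, 1 / 2 * ‖u s x‖ ^ 2 * G s x)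
      (-(∫ x, p t x * deriv (fun s => G s x) t) - ν * adaptedEnstrophy u G t) t := by
  refine (bernoulliCloud_hasDerivAt hG hS₀ hS₀S hcl hM hGM hU hDu hD2u hut hp hDG hΔG
    ht).congr_deriv ?_
  have hint : ∫ x, p t x * (fderiv ℝ (G t) x (u t x) + ν * (Δ (G t)) x) =
      -(∫ x, p t x * deriv (fun s => G s x) t) := by
    rw [← integral_neg]
    refine integral_congr_ae (Eventually.of_forall fun x => ?_)
    have h := hG.adjoint_eq t (hS₀S ht) x
    rw [timeDerivWithin_apply,
      derivWithin_of_mem_nhds (mem_of_superset (hS₀.mem_nhds ht) hS₀S)] at h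
    show p t x * (fderiv ℝ (G t) x (u t x) + ν * (Δ (G t)) x) =
      -(p t x * deriv (fun s => G s x) t)
    have h' : fderiv ℝ (G t) x (u t x) + ν * (Δ (G t)) x = -deriv (fun s => G s x) t := by
      linarith
    rw [h']
    ring
  rw [hint]

/-- **Tsai's formula for the cloud.** Under the hypotheses of `bernoulliCloud_hasDerivAt` and
`ν ≠ 0`, at every `t ∈ S₀` the adapted enstrophy is
`adaptedEnstrophy u G t = −(∫ p(t) ∂ₜG(t) + d/dt ∫ ½‖u‖² G) / ν`:
`H` is read off the pressure paired with `∂ₜG` and the time derivative of the kernel-weighted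
energy. In particular a steady cloud (`∂ₜG(t) = 0` and `d/dt ∫ ½‖u‖² G = 0` at `t`) has
`H(t) = 0`, hence `curl u(t) ≡ 0` on `{G(t) > 0} = ℝ³` — Tsai's theorem in one line. -/
theorem adaptedEnstrophy_eq_of_bernoulliCloud {ν T K : ℝ}
    {u : ℝ → EuclideanSpace ℝ (Fin 3) → EuclideanSpace ℝ (Fin 3)}
    {p : ℝ → EuclideanSpace ℝ (Fin 3) → ℝ}
    {S S₀ : Set ℝ} {x₀ : EuclideanSpace ℝ (Fin 3)} {G : ℝ → EuclideanSpace ℝ (Fin 3) → ℝ}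
    {M : EuclideanSpace ℝ (Fin 3) → ℝ}
    (hG : IsAdaptedBackwardKernel ν u S T x₀ G) (hS₀ : IsOpen S₀) (hS₀S : S₀ ⊆ S)
    (hcl : IsClassicalNSSolutionOn S₀ ν 0 u p)
    (hM : Integrable M) (hGM : ∀ t ∈ S₀, ∀ x, G t x ≤ M x)
    (hU : ∀ t ∈ S₀, ∀ x, ‖u t x‖ ≤ K) (hDu : ∀ t ∈ S₀, ∀ x, ‖fderiv ℝ (u t) x‖ ≤ K)
    (hD2u : ∀ t ∈ S₀, ∀ x, ‖iteratedFDeriv ℝ 2 (u t) x‖ ≤ K)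
    (hut : ∀ t ∈ S₀, ∀ x, ‖deriv (fun s => u s x) t‖ ≤ K)
    (hp : ∀ t ∈ S₀, ∀ x, |p t x| ≤ K * (1 + ‖x‖))
    (hDG : ∀ t ∈ S₀, Integrable fun x => (1 + ‖x‖) * ‖fderiv ℝ (G t) x‖)
    (hΔG : ∀ t ∈ S₀, Integrable fun x => (1 + ‖x‖) * |(Δ (G t)) x|) (hν : ν ≠ 0) {t : ℝ}
    (ht : t ∈ S₀) :
    adaptedEnstrophy u G t =
      -((∫ x, p t x * deriv (fun s => G s x) t) +
        deriv (fun s => ∫ x, 1 / 2 * ‖u s x‖ ^ 2 * G s x) t) / ν := by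
  rw [(bernoulliCloud_hasDerivAt_adjointForm hG hS₀ hS₀S hcl hM hGM hU hDu hD2u hut hp hDG hΔG
    ht).deriv]
  field_simp
  ring

end R3

end Summit.NavierStokesRegularity.NavierStokesRegularity.Theorems.AdaptedFrequencyConverges.CloudFrameEffectiveTsai

end
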